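import Mathlib.NumberTheory.NumberField.InfinitePlace.TotallyRealComplex
import Mathlib.GroupTheory.Perm.Cycle.Type
import Literature.NumberTheory.NumberFields.TotallyComplexEvenDegree
import HarnessLib

/-!
# PARITY: a totally complex number field has even degree over every totally real subfield
# (route `MarkmanPartnerTransport`, crux #5 `LowPicardRealMultiplication`, stmt-HodgeConjecture-19653; planner P1 g38
# memo ROUTE-P1AK §B «PARITY LAW»)

Prover seat `hodge-nonav-19716-p2` (g6), task «PARITY» of planner P1 g38 (STATUS 14:17:33Z; target typed in
`HOME/p1/route/Sketch_P1AK_Cells_g38.lean` :175). Landed `--supports stmt-HodgeConjecture-19653 --as helper`; pure Mathlib,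
sorry-free, no definition, no named fact. Nothing here says HC ∕ HC_AV is proved; rung F-H1 is not moved.

**Theorem** (`even_finrank_of_isTotallyReal_of_isTotallyComplex`). If `F ⊆ K` are number fields with `F` totally real and
`K` totally complex, then `[K : F]` is even.

Proof: fix an embedding `ψ : F → ℂ` (real, as `F` is totally real). The `[K : F]` embeddings `φ : K → ℂ` extending `ψ`
(`card_extensions_eq_finrank`, Mathlib's `AlgHom.card` for the `F`-structure `ψ` on `ℂ`) are permuted by complex
conjugation (`ψ̄ = ψ`), an involution WITHOUT fixed points (a fixed `φ` would be a real embedding of the totally complex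
`K`); a fixed-point-free involution of a finite set has even cardinality (`Equiv.Perm.exists_fixed_point_of_prime`).

CANONICAL HOME (appended 14:40Z): the pure lemma crossed in flight with the Literature copy
`Literature.NumberTheory.NumberFields.even_finrank_of_isTotallyReal_of_isTotallyComplex` (seat 20241-p1 g14, p640830,
accepted one minute later); THAT is the canonical declaration — this copy is kept (append-only file) for the PARITY-LAW
consumers of route MarkmanPartnerTransport and is marked `deprecated` below, so any future citer is redirected.

Why it matters (memo ROUTE-P1AK §B): real multiplication induced by a Hodge isometry of finite order on the
transcendental lattice has `E = ℚ(ζ_n)⁺ ⊆ K = ℚ(ζ_n)|_T`, so `l = [T_ℚ : E]`-type invariants are EVEN — the four OPEN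
cells of crux #5 are exactly the odd ones.

## References

* [MilneFT2022] J. S. Milne, Fields and Galois Theory (v5.10, 2022), Prop. 2.7 (counting embeddings).
* [Shimura1998] G. Shimura, Abelian Varieties with Complex Multiplication and Modular Functions (1998), §5.2 p. 39
  («`F` must be totally imaginary»: a CM field has even degree over its maximal real subfield).
-/

noncomputable section

-- mandated namespace `Summit.HodgeConjecture.HodgeConjecture.Theorems` trips `linter.dupNamespace` (off tree-wide)
set_option linter.dupNamespace false

open Module NumberField

namespace Summit.HodgeConjecture.HodgeConjecture.Theorems.PartnerLattice

open scoped Classical in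
/-- **`#{φ : K → ℂ ∣ φ|_F = ψ} = [K : F]`** for number fields `F ⊆ K`: the extensions of `ψ` are the `F`-algebra
homomorphisms `K → ℂ` for the `F`-structure `ψ` on `ℂ` (Mathlib `AlgHom.card`). [cite: MilneFT2022, Prop. 2.7] -/
private theorem card_extensions_eq_finrank (F K : Type) [Field F] [NumberField F] [Field K] [NumberField K] [Algebra F K]
    (ψ : F →+* ℂ) : Fintype.card {φ : K →+* ℂ // φ.comp (algebraMap F K) = ψ} = finrank F K := by
  letI : Algebra F ℂ := ψ.toAlgebra
  haveI : IsScalarTower ℚ F K :=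
    IsScalarTower.of_algebraMap_eq fun x => (map_ratCast (algebraMap F K) x).symm
  haveI : Module.Finite F K := Module.Finite.of_restrictScalars_finite ℚ F K
  have e : {φ : K →+* ℂ // φ.comp (algebraMap F K) = ψ} ≃ (K →ₐ[F] ℂ) :=
    { toFun := fun φ => { toRingHom := φ.1, commutes' := fun r => RingHom.congr_fun φ.2 r }
      invFun := fun χ => ⟨χ.toRingHom, χ.comp_algebraMap⟩
      left_inv := fun φ => rfl
      right_inv := fun χ => rfl }
  rw [Fintype.card_congr e, AlgHom.card]

/-- **PARITY: a totally complex number field has even degree over a totally real subfield.** For number fields `F ⊆ K`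
with `F` totally real and `K` totally complex, `[K : F]` is even: complex conjugation is a fixed-point-free involution of
the `[K : F]` embeddings `K → ℂ` over a fixed (real) embedding of `F`. [cite: Shimura1998, §5.2 p. 39]
[cite: MilneFT2022, Prop. 2.7] -/
theorem even_finrank_of_isTotallyReal_of_isTotallyComplex (F K : Type) [Field F] [NumberField F] [Field K]
    [NumberField K] [Algebra F K] [NumberField.IsTotallyReal F] [NumberField.IsTotallyComplex K] :
    Even (Module.finrank F K) := by
  classical
  -- a (real) embedding of `F`
  have hpos : 0 < Fintype.card (F →+* ℂ) := by
    rw [NumberField.Embeddings.card]; exact Module.finrank_pos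
  obtain ⟨ψ⟩ := Fintype.card_pos_iff.mp hpos
  have hψ : ComplexEmbedding.conjugate ψ = ψ :=
    ComplexEmbedding.isReal_iff.mp (IsTotallyReal.complexEmbedding_isReal ψ)
  -- complex conjugation on the extensions of `ψ`
  let S := {φ : K →+* ℂ // φ.comp (algebraMap F K) = ψ}
  let c : S → S := fun φ => ⟨ComplexEmbedding.conjugate φ.1, by
    rw [ComplexEmbedding.conjugate_comp, φ.2, hψ]⟩
  have hc : Function.Involutive c := fun φ =>
    Subtype.ext (ComplexEmbedding.involutive_conjugate K φ.1)
  let σ : Equiv.Perm S := hc.toPerm c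
  have hσ : σ ^ 2 ^ 1 = 1 := by
    ext φ : 1
    change c (c φ) = φ
    exact hc φ
  -- no fixed point: a fixed extension would be a real embedding of `K`
  have hfix : ∀ φ : S, σ φ ≠ φ := fun φ h =>
    IsTotallyComplex.complexEmbedding_not_isReal φ.1 (ComplexEmbedding.isReal_iff.mpr (congrArg Subtype.val h))
  -- hence `#S = [K : F]` is even
  rw [← card_extensions_eq_finrank F K ψ, even_iff_two_dvd]
  by_contra h2
  haveI : Fact (Nat.Prime 2) := ⟨Nat.prime_two⟩
  obtain ⟨φ, hφ⟩ := Equiv.Perm.exists_fixed_point_of_prime (p := 2) (n := 1) h2 hσ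
  exact hfix φ hφ

/-! ### Canonical home of the pure lemma (appended): redirect to the Literature declaration -/

attribute [deprecated Literature.NumberTheory.NumberFields.even_finrank_of_isTotallyReal_of_isTotallyComplex
  (since := "2026-08-28")] even_finrank_of_isTotallyReal_of_isTotallyComplex

end Summit.HodgeConjecture.HodgeConjecture.Theorems.PartnerLattice

end
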